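import Summits.QuantumFields.BalabanUV.Beta.RemainderExplicitHistoryDiagonalWindowSource

/-!
# RemainderExplicitHistoryDiagonalRate — ROAD P3, ORDER-0 PROFILE FAMILY: THE RATE IN THE CUTOFF — under SHAPE hypotheses on a tail
# majorant `τ` of the profile (`Σ_{a∈[k,N)} ρ(a) ≤ τ(k)`, `τ ≥ 0` non-increasing; (T1) `Σ_{a<N} ρ(a)·min(a,K)² ≤ A₁·K²·τ(K)` for `K ≥ 1`;
# (T2) `Σ_{i<j₀} τ(i+1)τ(j₀−i)∕(j₀+1−i) ≤ A₂·τ(j₀+1)`) the matched discrepancy of two infrared-pinned runs at infrared distance `σ` in the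
# infrared half obeys `d ≤ Λ·√σ·τ(K−σ+1)` whenever `A₂ ≤ b√b·√σ`, `Λ = 4∕√b + 8√2κA₁∕((1 − Wγ∕b)√b)`; hence for a pinned FAMILY of runs
# `astar g m − invSq g m n ≤ Λ·√m·τ(n+1)` for `m ≤ n + 1` — the TAILS of the profile buy the RATE (third file of station S-d4p3-g49-1 «the
# rate in the cutoff»; the fourth gives the smallness-free lower side from a tail minorant, the fifth instantiates `τ(k) = 3M∕√(k+1)` on the
# road's borderline profile)

Cell `pub-balaban`, β-function sub-cell, BINDER row D4 «RemainderConst leaves for Bałaban's split» (`HOME/BINDER-OWNERS.md`; owner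
lineage `b2b-balaban-beta-an4`; this file by co-owner #3 lineage `b2b-balaban-beta-d4-p3`, road P3 «the reduction road», generation 49,
station S-d4p3-g49-1, third file; imports the station's second file `RemainderExplicitHistoryDiagonalWindowSource`), β-FLOW TEAM duty (1);
FREEZE (0) honoured (def-free module in road P3's own `RemainderExplicit*` series; no leaf, no interface, no Literature file).  SOURCE OF THE
SHAPES ONLY: [Balaban1987RG1] (0.20) p. 256, (0.31) and Thm 2 p. 259, §5 p. 298.  Pure real analysis about ONE explicit toy family (ours).

HONEST FRAMING (page 1 of everything the β sub-cell writes).  *"Discharging BetaPertH makes Bałaban's UV stability UNCONDITIONAL — a real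
constructive-QFT result; it is NOT the continuum limit and NOT the Clay problem."*  THIS FILE DISCHARGES NOTHING OF THE KIND.  Node U2's
typed NE4 (`ScaleShiftRate`, `FadingMemory`: GEOMETRIC shapes) buys a GEOMETRIC rate of the cutoff discrepancies, uniformly in the cutoff;
generation 47 showed that for road P3's order-0 profile family mere summability of the memory profile `ρ` buys EXISTENCE of the continuum
coupling (and that NE4 as typed holds iff `ρ` is geometric), generation 48 which moment of `ρ` buys UNIFORMITY in the infrared distance.  This
file closes the census line with the RATE: the second file bounded the discrepancy at infrared distance `σ` by the window's missing ages
`𝒯 ≤ 2√σ·τ(K−σ+1)` (`τ` a tail majorant) plus the ULTRAVIOLET FEEDBACK `Σ_{i<j₀} ((g^A_i)³∕2)·d_i·(R(K−i) − R(j₀−i))`; here a MAJORANT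
INDUCTION from the ultraviolet end resolves the feedback (§2): the ultraviolet half of the run is bounded by generation 48's global
sandwich (`shift_disc_le_src` + `src_le`) and hypothesis (T1) (the `min(a,K)²`-moment of `ρ` against `K²τ(K)` — for polynomial tails an
identity of exponents), the infrared half position by position, the convolution hypothesis (T2) reproducing the majorant `Λ√(K−i)·τ(i+1)`
(the cube of the asymptotically free coupling, `≤ 1∕(2(b(K−i))^{3∕2})`, turns `√(K−i)` into `1∕(K−i) ≤ 1∕(j₀+1−i)`).  The threshold
`A₂ ≤ b√b·√σ` is where the feedback's `ΛA₂∕(2b√b)` fits under half the majorant; for small `A₂` (small profile) it is void from `σ = 1` on.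
(T2) FAILS for geometric `τ` (a harmonic factor) — consistently: there the true discrepancy at the ultraviolet positions is NOT of the shape
`√(K−i)·τ(i+1)`, and node U2's own theorem is the right statement; the hypotheses here are the POLYNOMIAL world's (fifth file: the borderline
`p = 3∕2`).  The fourth file adds the smallness-free LOWER side from a tail minorant, so that for power tails the law is two-sided:
`astar g m − invSq g m n ≍ √m·(n+1)^{−q}` (`m ≤ n+1`, lower side for the running maximum over `m′ ≤ m`, as in generation 48).  Nothing of Bałaban's (1.22) is asserted or
constructed; row D4 class UNCHANGED (critical-path width 0; instance 0∕1; D4 DISCHARGE NO DATE); NOT B12 Thm 2, NOT BetaPertH, NOT continuum,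
NOT Clay.  HONEST DEPENDENCY: continuum YM on T⁴ ⇐ BetaPertH ∧ nine spine estimates (0/9 proved); BetaPertH ⇐ (D1) ∧ (D4) ∧ CAP+tail;
G-an2-4 gates asym, D1 and NE2/3/4.  ABSOLUTE RULE: nothing is cited as a fact.

WHAT IS PROVED ([folklore]; 0 sorry; 0 `def`; hypotheses as in the first two files plus the tail majorant `τ` with (T1), (T2)).
* §1 helpers: `sum_inv_sqrt_window` (`Σ_{j∈[j₀,K)} 1∕√(K−j) ≤ 2√(K−j₀)`), `cube_half_le` (`(g_i)³∕2 ≤ (1∕(2b√b))·1∕((K−i)√(K−i))` on a box run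
  with the floor), `tailWindow_le` (`𝒯 ≤ 2√(K−j₀)·τ(j₀+1)`), **`uvHalf_le`** (`2i ≤ K` ⇒ `d_i ≤ (8√2κA₁∕((1−Wγ∕b)√b))·√(K−i)·τ(i+1)`).
* §2 **`disc_le_majorant`** (THE MAJORANT INDUCTION: `j₀ ≤ K`, `K ≤ 2j₀+1`, `A₂ ≤ b√b·√(K−j₀)` ⇒ `d_{j₀} ≤ Λ√(K−j₀)·τ(j₀+1)`),
  **`invSq_sub_le_rate`** (family form between the cutoffs `n` and `n + n′`), **`astar_sub_invSq_le_rate`**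
  (`astar g m − invSq g m n ≤ Λ√m·τ(n+1)` for `A₂ ≤ b√b√m`, `m ≤ n+1`).
All letters NOT-IN-PRINT; `BetaFlowAsPrinted S` records a Markov β_n only ⇒ no junction of the as-printed interface changes.
-/

noncomputable section

open Finset Filter Topology

namespace Summit.QuantumFields.BalabanUV.Beta.RemainderExplicitHistoryDiagonalRate

open Literature.MathematicalPhysics.QuantumFieldTheory.Balaban1983to89
open Literature.MathematicalPhysics.QuantumFieldTheory.Balaban1983to89.FlowStep
open Literature.MathematicalPhysics.QuantumFieldTheory.Balaban1983to89.T4CouplingMatching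
open Literature.MathematicalPhysics.QuantumFieldTheory.Balaban1983to89.T4ContinuumCoupling
open Literature.MathematicalPhysics.QuantumFieldTheory.Balaban1983to89.T4OneLoopAsymptotics (sum_inv_sqrt_mul_succ_le)
open Summit.QuantumFields.BalabanUV.Beta.RemainderExplicitHistoryDiagonalMonotone
open Summit.QuantumFields.BalabanUV.Beta.RemainderExplicitHistoryDiagonalWeights
open Summit.QuantumFields.BalabanUV.Beta.RemainderExplicitHistoryDiagonalTwoRun
open Summit.QuantumFields.BalabanUV.Beta.RemainderExplicitHistoryDiagonalSource
open Summit.QuantumFields.BalabanUV.Beta.RemainderExplicitHistoryDiagonalWindow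
open Summit.QuantumFields.BalabanUV.Beta.RemainderExplicitHistoryDiagonalWindowSource

variable {β : HBeta} {b γ W A₁ A₂ : ℝ} {ρ τ : ℕ → ℝ}

/-! ## §1 Helpers: the window's profile sum, the cube of the coupling, the window source by the majorant, the ultraviolet half -/

/-- `Σ_{j∈[j₀,K)} 1∕√(K−j) ≤ 2√(K−j₀)` (node an1's `sum_inv_sqrt_mul_succ_le` at `b = 1`, reflected). [folklore] -/
theorem sum_inv_sqrt_window (j₀ K : ℕ) :
    ∑ j ∈ Ico j₀ K, 1 / Real.sqrt ((K - j : ℕ) : ℝ) ≤ 2 * Real.sqrt ((K - j₀ : ℕ) : ℝ) := by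
  rcases Nat.lt_or_ge j₀ K with hK | hK
  swap
  · rw [Finset.Ico_eq_empty (by omega), Finset.sum_empty]; positivity
  have h := sum_inv_sqrt_mul_succ_le one_pos (K - j₀)
  rw [Real.sqrt_one, div_one] at h
  rw [Finset.sum_Ico_eq_sum_range, ← Finset.sum_range_reflect (fun t => 1 / Real.sqrt ((K - (j₀ + t) : ℕ) : ℝ)) (K - j₀)]
  refine le_trans (le_of_eq (Finset.sum_congr rfl fun t ht => ?_)) h
  have ht' := Finset.mem_range.mp ht
  rw [one_mul, show K - (j₀ + (K - j₀ - 1 - t)) = t + 1 by omega]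
  push_cast
  ring_nf

/-- THE CUBE OF THE COUPLING on a box run with the floor `b ≤ β`: `(g_i)³∕2 ≤ (1∕(2b√b))·1∕((K−i)√(K−i))` for `i < K`
(`…Weights.cube_le_weight` with `√(1∕γ² + b(K−i)) ≥ √(b(K−i))`). [cite: Balaban1987RG1, (0.31) p.259] -/
theorem cube_half_le {K : ℕ} {g : ℕ → ℝ} (hγ : 0 < γ) (hb : 0 < b) (h : RGEqH K β g)
    (hbox : ∀ i, i ≤ K → 0 < g i ∧ g i ≤ γ) (hlo : BetaLowerH b γ β) {i : ℕ} (hi : i < K) :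
    (g i) ^ 3 / 2 ≤ 1 / (2 * b * Real.sqrt b) * (1 / (((K - i : ℕ) : ℝ) * Real.sqrt ((K - i : ℕ) : ℝ))) := by
  have hs : (0 : ℝ) < ((K - i : ℕ) : ℝ) := by exact_mod_cast (show 0 < K - i by omega)
  have hss : 0 < Real.sqrt ((K - i : ℕ) : ℝ) := Real.sqrt_pos.2 hs
  have hsb : 0 < Real.sqrt b := Real.sqrt_pos.2 hb
  have h1 := cube_le_weight hγ hb h hbox hlo hi.le
  have hp0 := sprof_pos hγ hb.le (K - i)
  -- `√(b(K−i)) ≤ sprof γ b (K−i)`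
  have hle : Real.sqrt b * Real.sqrt ((K - i : ℕ) : ℝ) ≤ sprof γ b (K - i) := by
    rw [← Real.sqrt_mul hb.le]
    unfold sprof prof
    exact Real.sqrt_le_sqrt (by linarith [show (0 : ℝ) ≤ 1 / γ ^ 2 by positivity])
  have hq0 : 0 < Real.sqrt b * Real.sqrt ((K - i : ℕ) : ℝ) := by positivity
  have h2 : 1 / sprof γ b (K - i) ≤ 1 / (Real.sqrt b * Real.sqrt ((K - i : ℕ) : ℝ)) := one_div_le_one_div_of_le hq0 hle
  have h3 : 1 / (sprof γ b (K - i)) ^ 2 ≤ (1 / (Real.sqrt b * Real.sqrt ((K - i : ℕ) : ℝ))) ^ 2 := by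
    rw [← one_div_pow]
    exact pow_le_pow_left₀ (by positivity) h2 2
  have h4 : (g i) ^ 3 ≤ (1 / (Real.sqrt b * Real.sqrt ((K - i : ℕ) : ℝ))) ^ 2 * (1 / (Real.sqrt b * Real.sqrt ((K - i : ℕ) : ℝ))) :=
    h1.trans (mul_le_mul h3 h2 (by positivity) (by positivity))
  have e : (1 / (Real.sqrt b * Real.sqrt ((K - i : ℕ) : ℝ))) ^ 2 * (1 / (Real.sqrt b * Real.sqrt ((K - i : ℕ) : ℝ)))
      = 1 / (b * Real.sqrt b) * (1 / (((K - i : ℕ) : ℝ) * Real.sqrt ((K - i : ℕ) : ℝ))) := by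
    have eb : Real.sqrt b * Real.sqrt b = b := Real.mul_self_sqrt hb.le
    have es : Real.sqrt ((K - i : ℕ) : ℝ) * Real.sqrt ((K - i : ℕ) : ℝ) = ((K - i : ℕ) : ℝ) := Real.mul_self_sqrt hs.le
    field_simp
    nlinarith [eb, es]
  rw [e] at h4
  have : (g i) ^ 3 / 2 = (g i) ^ 3 * (1 / 2) := by ring
  rw [this, show 1 / (2 * b * Real.sqrt b) * (1 / (((K - i : ℕ) : ℝ) * Real.sqrt ((K - i : ℕ) : ℝ)))
    = (1 / (b * Real.sqrt b) * (1 / (((K - i : ℕ) : ℝ) * Real.sqrt ((K - i : ℕ) : ℝ)))) * (1 / 2) by ring]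
  exact mul_le_mul_of_nonneg_right h4 (by norm_num)

/-- THE WINDOW SOURCE BY THE MAJORANT: if `Σ_{a∈[k,N)} ρ(a) ≤ τ(k)` (as `R(N) − R(k) ≤ τ(k)`) with `τ ≥ 0` non-increasing, then
`𝒯 = Σ_{j∈[j₀,K)} (R(j+n+1) − R(j+1))∕√(K−j) ≤ 2√(K−j₀)·τ(j₀+1)`. [folklore] -/
theorem tailWindow_le (hτ0 : ∀ k, 0 ≤ τ k) (hτmono : ∀ k l, k ≤ l → τ l ≤ τ k)
    (hτ : ∀ k N, k ≤ N → ∑ a ∈ range N, ρ a - ∑ a ∈ range k, ρ a ≤ τ k) (j₀ K n : ℕ) :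
    ∑ j ∈ Ico j₀ K, (∑ a ∈ range (j + n + 1), ρ a - ∑ a ∈ range (j + 1), ρ a) / Real.sqrt ((K - j : ℕ) : ℝ)
      ≤ 2 * Real.sqrt ((K - j₀ : ℕ) : ℝ) * τ (j₀ + 1) := by
  calc ∑ j ∈ Ico j₀ K, (∑ a ∈ range (j + n + 1), ρ a - ∑ a ∈ range (j + 1), ρ a) / Real.sqrt ((K - j : ℕ) : ℝ)
      ≤ ∑ j ∈ Ico j₀ K, τ (j₀ + 1) * (1 / Real.sqrt ((K - j : ℕ) : ℝ)) := by
        refine Finset.sum_le_sum fun j hj => ?_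
        have hj' := Finset.mem_Ico.mp hj
        rw [div_eq_mul_one_div]
        exact mul_le_mul_of_nonneg_right ((hτ (j + 1) (j + n + 1) (by omega)).trans (hτmono _ _ (by omega))) (by positivity)
    _ = τ (j₀ + 1) * ∑ j ∈ Ico j₀ K, 1 / Real.sqrt ((K - j : ℕ) : ℝ) := by rw [Finset.mul_sum]
    _ ≤ τ (j₀ + 1) * (2 * Real.sqrt ((K - j₀ : ℕ) : ℝ)) := mul_le_mul_of_nonneg_left (sum_inv_sqrt_window j₀ K) (hτ0 _)
    _ = 2 * Real.sqrt ((K - j₀ : ℕ) : ℝ) * τ (j₀ + 1) := by ring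

/-- **THE ULTRAVIOLET HALF.**  Two runs of the order-0 profile family in ]0,γ] (`b > 0`, `ρ ≥ 0`, `Σ_{a<N} ρ_a ≤ W`, `Wγ < b`) — A: `K ≥ 1`
steps, B: `K + n` steps — pinned `g^A_K = g^B_{K+n}`; a tail majorant `τ ≥ 0`, non-increasing, with (T1) `Σ_{a<N} ρ(a)·min(a,K)² ≤ A₁·K²·τ(K)`.
THEN at every position `i` with `2i ≤ K`: `d_i ≤ (8√2κA₁∕((1−Wγ∕b)√b))·√(K−i)·τ(i+1)`, `κ = (b+Wγ)∕b` — generation 48's global sandwich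
`d ≤ src∕(1−Wγ∕b)`, `src ≤ (8κ∕(K√(bK)))·Σ_a ρ(a)min(a,K)²`, and `√K ≤ √2·√(K−i)`, `τ(K) ≤ τ(i+1)`. [cite: Balaban1987RG1, (0.20) p.256, (0.31) and Thm 2 p.259] -/
theorem uvHalf_le
    (hβ : ∀ (k : ℕ) (p : Fin (k + 1) → ℝ),
      β k p = b + ∑ i : Fin (k + 1), ρ (k - i) * min (p (Fin.last k)) (|p (Fin.last k) - p i|))
    (hb : 0 < b) (hγ : 0 < γ) (hρ0 : ∀ a, 0 ≤ ρ a) (hρW : ∀ n, ∑ a ∈ range n, ρ a ≤ W) (hsmall : W * γ < b)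
    (hτ0 : ∀ k, 0 ≤ τ k) (hτmono : ∀ k l, k ≤ l → τ l ≤ τ k) (hA₁ : 0 ≤ A₁)
    (hUV : ∀ K N : ℕ, 1 ≤ K → ∑ a ∈ range N, ρ a * (min (a : ℝ) K) ^ 2 ≤ A₁ * (K : ℝ) ^ 2 * τ K)
    {K n : ℕ} (hK : 1 ≤ K) {gA gB : ℕ → ℝ} (hA : RGEqH K β gA) (hB : RGEqH (K + n) β gB)
    (hAbox : ∀ k, k ≤ K → 0 < gA k ∧ gA k ≤ γ) (hBbox : ∀ k, k ≤ K + n → 0 < gB k ∧ gB k ≤ γ)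
    (hpin : gA K = gB (K + n)) {i : ℕ} (hi : 2 * i ≤ K) :
    1 / (gB (i + n)) ^ 2 - 1 / (gA i) ^ 2
      ≤ 8 * Real.sqrt 2 * ((b + W * γ) / b) * A₁ / ((1 - W * γ / b) * Real.sqrt b)
        * Real.sqrt ((K - i : ℕ) : ℝ) * τ (i + 1) := by
  have hW : 0 ≤ W := by simpa using hρW 0
  have hq : 0 < 1 - W * γ / b := by
    have : W * γ / b < 1 := by rw [div_lt_one hb]; exact hsmall
    linarith
  have hκ : 0 ≤ (b + W * γ) / b := by positivity
  have hKr : (1 : ℝ) ≤ K := by exact_mod_cast hK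
  have hKpos : (0 : ℝ) < K := by linarith
  have hsb : 0 < Real.sqrt b := Real.sqrt_pos.2 hb
  have hsK : 0 < Real.sqrt (K : ℝ) := Real.sqrt_pos.2 hKpos
  have hd := (shift_disc_le_src hβ hb hγ hρ0 hρW hsmall hA hB hAbox hBbox hpin i (by omega)).2
  have hsrc := src_le hβ hb hγ hρ0 hρW hK hB hBbox (n := n)
  have hmin := hUV K (K + n) hK
  have hc0 : 0 ≤ 8 * ((b + W * γ) / b) / ((K : ℝ) * Real.sqrt (b * K)) := by positivity
  -- `d_i ≤ 8κ A₁ K² τ(K) ∕ ((1 − Wγ∕b) K √(bK))`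
  have h1 : 1 / (gB (i + n)) ^ 2 - 1 / (gA i) ^ 2
      ≤ 8 * ((b + W * γ) / b) / ((K : ℝ) * Real.sqrt (b * K)) * (A₁ * (K : ℝ) ^ 2 * τ K) / (1 - W * γ / b) :=
    hd.trans (div_le_div_of_nonneg_right (hsrc.trans (mul_le_mul_of_nonneg_left hmin hc0)) hq.le)
  -- algebra: `K² ∕ (K√(bK)) = √K ∕ √b`
  have eK : Real.sqrt (K : ℝ) * Real.sqrt (K : ℝ) = K := Real.mul_self_sqrt hKpos.le
  have hsbK : 0 < Real.sqrt (b * K) := Real.sqrt_pos.2 (by positivity)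
  have e0 : (K : ℝ) ^ 2 / ((K : ℝ) * Real.sqrt (b * K)) = Real.sqrt (K : ℝ) / Real.sqrt b := by
    rw [div_eq_div_iff (by positivity) hsb.ne', Real.sqrt_mul hb.le]
    linear_combination (-((K : ℝ) * Real.sqrt b)) * eK
  have e1 : 8 * ((b + W * γ) / b) / ((K : ℝ) * Real.sqrt (b * K)) * (A₁ * (K : ℝ) ^ 2 * τ K) / (1 - W * γ / b)
      = 8 * ((b + W * γ) / b) * A₁ / ((1 - W * γ / b) * Real.sqrt b) * Real.sqrt (K : ℝ) * τ K := by
    rw [show 8 * ((b + W * γ) / b) / ((K : ℝ) * Real.sqrt (b * K)) * (A₁ * (K : ℝ) ^ 2 * τ K) / (1 - W * γ / b)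
      = 8 * ((b + W * γ) / b) * A₁ * τ K / (1 - W * γ / b) * ((K : ℝ) ^ 2 / ((K : ℝ) * Real.sqrt (b * K))) by
        field_simp, e0]
    field_simp
  rw [e1] at h1
  -- `√K ≤ √2 √(K−i)` and `τ(K) ≤ τ(i+1)`
  have hKi : ((K : ℕ) : ℝ) ≤ 2 * ((K - i : ℕ) : ℝ) := by exact_mod_cast (show K ≤ 2 * (K - i) by omega)
  have h2 : Real.sqrt (K : ℝ) ≤ Real.sqrt 2 * Real.sqrt ((K - i : ℕ) : ℝ) := by
    rw [← Real.sqrt_mul (by norm_num : (0:ℝ) ≤ 2)]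
    exact Real.sqrt_le_sqrt hKi
  have h3 : τ K ≤ τ (i + 1) := hτmono _ _ (by omega)
  have hC0 : 0 ≤ 8 * ((b + W * γ) / b) * A₁ / ((1 - W * γ / b) * Real.sqrt b) := by positivity
  calc 1 / (gB (i + n)) ^ 2 - 1 / (gA i) ^ 2
      ≤ 8 * ((b + W * γ) / b) * A₁ / ((1 - W * γ / b) * Real.sqrt b) * Real.sqrt (K : ℝ) * τ K := h1
    _ ≤ 8 * ((b + W * γ) / b) * A₁ / ((1 - W * γ / b) * Real.sqrt b) * (Real.sqrt 2 * Real.sqrt ((K - i : ℕ) : ℝ)) * τ (i + 1) :=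
        mul_le_mul (mul_le_mul_of_nonneg_left h2 hC0) h3 (hτ0 _) (by positivity)
    _ = 8 * Real.sqrt 2 * ((b + W * γ) / b) * A₁ / ((1 - W * γ / b) * Real.sqrt b) * Real.sqrt ((K - i : ℕ) : ℝ) * τ (i + 1) := by
        ring

/-! ## §2 The majorant induction and the rate of the continuum coupling in the cutoff -/

/-- **THE MAJORANT INDUCTION.**  Two runs of the order-0 profile family in ]0,γ] (`b > 0`, `ρ ≥ 0`, `Σ_{a<N} ρ_a ≤ W`, `Wγ < b`) — A: `K`
steps, B: `K + n` steps — pinned `g^A_K = g^B_{K+n}`; a tail majorant `τ ≥ 0`, non-increasing, `R(N) − R(k) ≤ τ(k)` (`k ≤ N`), with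
(T1) `Σ_{a<N} ρ(a)min(a,K′)² ≤ A₁K′²τ(K′)` (`K′ ≥ 1`) and (T2) `Σ_{i<j₀} τ(i+1)τ(j₀−i)∕(j₀+1−i) ≤ A₂τ(j₀+1)`.  THEN at every position `j₀ ≤ K`
of the infrared half (`K ≤ 2j₀+1`) whose infrared distance `σ = K − j₀` has `A₂ ≤ b√b·√σ`:
`1∕(g^B_{j₀+n})² − 1∕(g^A_{j₀})² ≤ Λ·√σ·τ(j₀+1)`, `Λ = 4∕√b + 8√2κA₁∕((1−Wγ∕b)√b)`.
(Strong induction on `j₀` from the ultraviolet end: `window_law_upper`; the window source `≤ 2√σ·τ(j₀+1)∕√b ≤ (Λ∕2)√σ·τ(j₀+1)`; an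
ultraviolet position `i < j₀` contributes `((g^A_i)³∕2)·d_i·τ(j₀−i) ≤ (Λ∕(2b√b))·τ(i+1)τ(j₀−i)∕(j₀+1−i)` by `cube_half_le` and the majorant
at `i` — `uvHalf_le` when `2i ≤ K`, the induction hypothesis otherwise — so the feedback is `≤ ΛA₂τ(j₀+1)∕(2b√b) ≤ (Λ∕2)√σ·τ(j₀+1)`.)
[cite: Balaban1987RG1, (0.20) p.256, (0.31) and Thm 2 p.259] -/
theorem disc_le_majorant
    (hβ : ∀ (k : ℕ) (p : Fin (k + 1) → ℝ),
      β k p = b + ∑ i : Fin (k + 1), ρ (k - i) * min (p (Fin.last k)) (|p (Fin.last k) - p i|))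
    (hb : 0 < b) (hγ : 0 < γ) (hρ0 : ∀ a, 0 ≤ ρ a) (hρW : ∀ n, ∑ a ∈ range n, ρ a ≤ W) (hsmall : W * γ < b)
    (hτ0 : ∀ k, 0 ≤ τ k) (hτmono : ∀ k l, k ≤ l → τ l ≤ τ k)
    (hτ : ∀ k N, k ≤ N → ∑ a ∈ range N, ρ a - ∑ a ∈ range k, ρ a ≤ τ k) (hA₁ : 0 ≤ A₁)
    (hUV : ∀ K N : ℕ, 1 ≤ K → ∑ a ∈ range N, ρ a * (min (a : ℝ) K) ^ 2 ≤ A₁ * (K : ℝ) ^ 2 * τ K)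
    (hT2 : ∀ j₀ : ℕ, ∑ i ∈ range j₀, τ (i + 1) * τ (j₀ - i) / ((j₀ + 1 - i : ℕ) : ℝ) ≤ A₂ * τ (j₀ + 1))
    {K n : ℕ} {gA gB : ℕ → ℝ} (hA : RGEqH K β gA) (hB : RGEqH (K + n) β gB)
    (hAbox : ∀ k, k ≤ K → 0 < gA k ∧ gA k ≤ γ) (hBbox : ∀ k, k ≤ K + n → 0 < gB k ∧ gB k ≤ γ) (hpin : gA K = gB (K + n)) :
    ∀ j₀, j₀ ≤ K → K ≤ 2 * j₀ + 1 → A₂ ≤ b * Real.sqrt b * Real.sqrt ((K - j₀ : ℕ) : ℝ) →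
      1 / (gB (j₀ + n)) ^ 2 - 1 / (gA j₀) ^ 2
        ≤ (4 / Real.sqrt b + 8 * Real.sqrt 2 * ((b + W * γ) / b) * A₁ / ((1 - W * γ / b) * Real.sqrt b))
          * Real.sqrt ((K - j₀ : ℕ) : ℝ) * τ (j₀ + 1) := by
  have hApos : ∀ k, k ≤ K → 0 < gA k := fun k hk => (hAbox k hk).1
  have hBpos : ∀ k, k ≤ K + n → 0 < gB k := fun k hk => (hBbox k hk).1
  have hlo : BetaLowerH b γ β :=
    RemainderExplicitHistoryHalfMomentWitness.lower (γ := γ) (lam := fun k i => ρ (k - i)) hβ (fun k i => hρ0 _)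
  have hW : 0 ≤ W := by simpa using hρW 0
  have hq : 0 < 1 - W * γ / b := by
    have : W * γ / b < 1 := by rw [div_lt_one hb]; exact hsmall
    linarith
  have hsb : 0 < Real.sqrt b := Real.sqrt_pos.2 hb
  have hbsb : 0 < b * Real.sqrt b := by positivity
  set Λ : ℝ := 4 / Real.sqrt b + 8 * Real.sqrt 2 * ((b + W * γ) / b) * A₁ / ((1 - W * γ / b) * Real.sqrt b) with hΛ
  have hΛ4 : 4 / Real.sqrt b ≤ Λ := by
    have : 0 ≤ 8 * Real.sqrt 2 * ((b + W * γ) / b) * A₁ / ((1 - W * γ / b) * Real.sqrt b) := by positivity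
    linarith
  have hΛ0 : 0 ≤ Λ := le_trans (by positivity) hΛ4
  have hdom := invSq_le_invSq_shift_run hβ hb hρ0 hA hB hApos hBpos hpin
  set d : ℕ → ℝ := fun j => 1 / (gB (j + n)) ^ 2 - 1 / (gA j) ^ 2 with hd
  have hdnn : ∀ j, j ≤ K → 0 ≤ d j := fun j hj => by have := hdom j hj; simp only [hd]; linarith
  -- strong induction on the position, from the ultraviolet end
  intro j₀
  induction j₀ using Nat.strong_induction_on with
  | _ j₀ ih =>
    intro hj₀ hIR hσ
    show d j₀ ≤ Λ * Real.sqrt ((K - j₀ : ℕ) : ℝ) * τ (j₀ + 1)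
    rcases Nat.eq_or_lt_of_le hj₀ with hjK | hjK
    · -- at the pin
      have : d j₀ = 0 := by simp [hd, hjK, hpin]
      rw [this]; exact mul_nonneg (mul_nonneg hΛ0 (Real.sqrt_nonneg _)) (hτ0 _)
    have hK : 1 ≤ K := by omega
    have hs : (0 : ℝ) < ((K - j₀ : ℕ) : ℝ) := by exact_mod_cast (show 0 < K - j₀ by omega)
    have hss : 0 < Real.sqrt ((K - j₀ : ℕ) : ℝ) := Real.sqrt_pos.2 hs
    -- the majorant at every ultraviolet position `i < j₀`
    have hM : ∀ i, i < j₀ → d i ≤ Λ * Real.sqrt ((K - i : ℕ) : ℝ) * τ (i + 1) := by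
      intro i hi
      by_cases hhalf : 2 * i ≤ K
      · have h := uvHalf_le hβ hb hγ hρ0 hρW hsmall hτ0 hτmono hA₁ hUV hK hA hB hAbox hBbox hpin hhalf
        refine h.trans (mul_le_mul_of_nonneg_right (mul_le_mul_of_nonneg_right ?_ (Real.sqrt_nonneg _)) (hτ0 _))
        have : 0 ≤ 4 / Real.sqrt b := by positivity
        linarith
      · have hσi : A₂ ≤ b * Real.sqrt b * Real.sqrt ((K - i : ℕ) : ℝ) := by
          refine hσ.trans (mul_le_mul_of_nonneg_left (Real.sqrt_le_sqrt ?_) hbsb.le)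
          exact_mod_cast (show K - j₀ ≤ K - i by omega)
        exact ih i hi (by omega) (by omega) hσi
    -- the upper window law
    have hup := window_law_upper hβ hb hρ0 hA hB hApos hBbox hpin hj₀ hIR
    -- the window source
    have hT := tailWindow_le hτ0 hτmono hτ j₀ K n
    have h1 : 1 / Real.sqrt b * (∑ j ∈ Ico j₀ K, (∑ a ∈ range (j + n + 1), ρ a - ∑ a ∈ range (j + 1), ρ a)
        / Real.sqrt ((K - j : ℕ) : ℝ)) ≤ Λ / 2 * Real.sqrt ((K - j₀ : ℕ) : ℝ) * τ (j₀ + 1) := by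
      calc 1 / Real.sqrt b * (∑ j ∈ Ico j₀ K, (∑ a ∈ range (j + n + 1), ρ a - ∑ a ∈ range (j + 1), ρ a)
            / Real.sqrt ((K - j : ℕ) : ℝ)) ≤ 1 / Real.sqrt b * (2 * Real.sqrt ((K - j₀ : ℕ) : ℝ) * τ (j₀ + 1)) :=
            mul_le_mul_of_nonneg_left hT (by positivity)
        _ = (4 / Real.sqrt b) / 2 * Real.sqrt ((K - j₀ : ℕ) : ℝ) * τ (j₀ + 1) := by ring
        _ ≤ Λ / 2 * Real.sqrt ((K - j₀ : ℕ) : ℝ) * τ (j₀ + 1) :=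
            mul_le_mul_of_nonneg_right (mul_le_mul_of_nonneg_right (by linarith) hss.le) (hτ0 _)
    -- the ultraviolet feedback, term by term
    have hterm : ∀ i ∈ range j₀, (gA i) ^ 3 / 2 * (1 / (gB (i + n)) ^ 2 - 1 / (gA i) ^ 2)
        * (∑ a ∈ range (K - i), ρ a - ∑ a ∈ range (j₀ - i), ρ a)
        ≤ Λ / (2 * b * Real.sqrt b) * (τ (i + 1) * τ (j₀ - i) / ((j₀ + 1 - i : ℕ) : ℝ)) := by
      intro i hi
      have hi' := Finset.mem_range.mp hi
      have hsi : (0 : ℝ) < ((K - i : ℕ) : ℝ) := by exact_mod_cast (show 0 < K - i by omega)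
      have hssi : 0 < Real.sqrt ((K - i : ℕ) : ℝ) := Real.sqrt_pos.2 hsi
      have hc := cube_half_le hγ hb hA hAbox hlo (show i < K by omega)
      have hdi := hM i hi'
      have hR : ∑ a ∈ range (K - i), ρ a - ∑ a ∈ range (j₀ - i), ρ a ≤ τ (j₀ - i) := hτ (j₀ - i) (K - i) (by omega)
      have hR0 : 0 ≤ ∑ a ∈ range (K - i), ρ a - ∑ a ∈ range (j₀ - i), ρ a := by
        linarith [partialSum_mono hρ0 (show j₀ - i ≤ K - i by omega)]
      have hg0 : 0 ≤ (gA i) ^ 3 / 2 := by have := hApos i (by omega); positivity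
      calc (gA i) ^ 3 / 2 * d i * (∑ a ∈ range (K - i), ρ a - ∑ a ∈ range (j₀ - i), ρ a)
          ≤ (1 / (2 * b * Real.sqrt b) * (1 / (((K - i : ℕ) : ℝ) * Real.sqrt ((K - i : ℕ) : ℝ))))
              * (Λ * Real.sqrt ((K - i : ℕ) : ℝ) * τ (i + 1)) * τ (j₀ - i) :=
            mul_le_mul (mul_le_mul hc hdi (hdnn i (by omega)) (by positivity)) hR hR0
              (mul_nonneg (by positivity) (mul_nonneg (mul_nonneg hΛ0 (Real.sqrt_nonneg _)) (hτ0 _)))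
        _ = Λ / (2 * b * Real.sqrt b) * (τ (i + 1) * τ (j₀ - i) / ((K - i : ℕ) : ℝ)) := by
            field_simp
        _ ≤ Λ / (2 * b * Real.sqrt b) * (τ (i + 1) * τ (j₀ - i) / ((j₀ + 1 - i : ℕ) : ℝ)) := by
            refine mul_le_mul_of_nonneg_left ?_ (by positivity)
            refine div_le_div_of_nonneg_left (mul_nonneg (hτ0 _) (hτ0 _)) ?_ ?_
            · exact_mod_cast (show 0 < j₀ + 1 - i by omega)
            · exact_mod_cast (show j₀ + 1 - i ≤ K - i by omega)
    have h2 : ∑ i ∈ range j₀, (gA i) ^ 3 / 2 * (1 / (gB (i + n)) ^ 2 - 1 / (gA i) ^ 2)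
        * (∑ a ∈ range (K - i), ρ a - ∑ a ∈ range (j₀ - i), ρ a) ≤ Λ / 2 * Real.sqrt ((K - j₀ : ℕ) : ℝ) * τ (j₀ + 1) := by
      calc ∑ i ∈ range j₀, (gA i) ^ 3 / 2 * (1 / (gB (i + n)) ^ 2 - 1 / (gA i) ^ 2)
            * (∑ a ∈ range (K - i), ρ a - ∑ a ∈ range (j₀ - i), ρ a)
          ≤ ∑ i ∈ range j₀, Λ / (2 * b * Real.sqrt b) * (τ (i + 1) * τ (j₀ - i) / ((j₀ + 1 - i : ℕ) : ℝ)) :=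
            Finset.sum_le_sum hterm
        _ = Λ / (2 * b * Real.sqrt b) * ∑ i ∈ range j₀, τ (i + 1) * τ (j₀ - i) / ((j₀ + 1 - i : ℕ) : ℝ) := by
            rw [Finset.mul_sum]
        _ ≤ Λ / (2 * b * Real.sqrt b) * (A₂ * τ (j₀ + 1)) := mul_le_mul_of_nonneg_left (hT2 j₀) (by positivity)
        _ ≤ Λ / (2 * b * Real.sqrt b) * (b * Real.sqrt b * Real.sqrt ((K - j₀ : ℕ) : ℝ) * τ (j₀ + 1)) :=
            mul_le_mul_of_nonneg_left (mul_le_mul_of_nonneg_right hσ (hτ0 _)) (by positivity)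
        _ = Λ / 2 * Real.sqrt ((K - j₀ : ℕ) : ℝ) * τ (j₀ + 1) := by field_simp
    have : d j₀ = 1 / (gB (j₀ + n)) ^ 2 - 1 / (gA j₀) ^ 2 := rfl
    linarith [hup, h1, h2]

/-- **FAMILY FORM BETWEEN TWO CUTOFFS.**  A family `K ↦ g K` of runs of the order-0 profile family in ]0,γ] pinned at one `g_IR`, with the
hypotheses of `disc_le_majorant`; THEN for all infrared distances `m` with `A₂ ≤ b√b·√m` and all cutoffs `n ≥ m − 1`, `n′`:
`invSq g m (n + n′) − invSq g m n ≤ Λ·√m·τ(n+1)`. [cite: Balaban1987RG1, (0.20) p.256, (0.31) and Thm 2 p.259] -/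
theorem invSq_sub_le_rate
    (hβ : ∀ (k : ℕ) (p : Fin (k + 1) → ℝ),
      β k p = b + ∑ i : Fin (k + 1), ρ (k - i) * min (p (Fin.last k)) (|p (Fin.last k) - p i|))
    (hb : 0 < b) (hγ : 0 < γ) (hρ0 : ∀ a, 0 ≤ ρ a) (hρW : ∀ n, ∑ a ∈ range n, ρ a ≤ W) (hsmall : W * γ < b)
    (hτ0 : ∀ k, 0 ≤ τ k) (hτmono : ∀ k l, k ≤ l → τ l ≤ τ k)
    (hτ : ∀ k N, k ≤ N → ∑ a ∈ range N, ρ a - ∑ a ∈ range k, ρ a ≤ τ k) (hA₁ : 0 ≤ A₁)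
    (hUV : ∀ K N : ℕ, 1 ≤ K → ∑ a ∈ range N, ρ a * (min (a : ℝ) K) ^ 2 ≤ A₁ * (K : ℝ) ^ 2 * τ K)
    (hT2 : ∀ j₀ : ℕ, ∑ i ∈ range j₀, τ (i + 1) * τ (j₀ - i) / ((j₀ + 1 - i : ℕ) : ℝ) ≤ A₂ * τ (j₀ + 1))
    {g : ℕ → ℕ → ℝ} {gIR : ℝ} (hrun : ∀ K, RGEqH K β (g K)) (hbox : ∀ K i, i ≤ K → 0 < g K i ∧ g K i ≤ γ)
    (hpin : ∀ K, g K K = gIR) {m n : ℕ} (hm : A₂ ≤ b * Real.sqrt b * Real.sqrt (m : ℝ)) (hmn : m ≤ n + 1) (n' : ℕ) :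
    invSq g m (n + n') - invSq g m n
      ≤ (4 / Real.sqrt b + 8 * Real.sqrt 2 * ((b + W * γ) / b) * A₁ / ((1 - W * γ / b) * Real.sqrt b))
        * Real.sqrt (m : ℝ) * τ (n + 1) := by
  have hpin' : g (n + m) (n + m) = g (n + m + n') (n + m + n') := by rw [hpin, hpin]
  have h := disc_le_majorant hβ hb hγ hρ0 hρW hsmall hτ0 hτmono hτ hA₁ hUV hT2 (hrun (n + m)) (hrun (n + m + n'))
    (hbox (n + m)) (hbox (n + m + n')) hpin' n (by omega) (by omega)
    (by rw [show n + m - n = m by omega]; exact hm)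
  rw [show n + m - n = m by omega] at h
  have e1 : invSq g m (n + n') = 1 / (g (n + m + n') (n + n')) ^ 2 := by
    rw [invSq_def, show n + n' + m = n + m + n' by omega]
  rw [e1, invSq_def]
  exact h

/-- **ROAD P3 — THE RATE OF THE CONTINUUM COUPLING IN THE CUTOFF.**  A family `K ↦ g K` of runs of the order-0 profile family
`β_{k+1} = b + Σ_{i≤k} ρ(k−i)·min(g_k, |g_k − g_i|)` in ]0,γ] pinned at one `g_IR` (`b > 0`, `ρ ≥ 0`, `Σ_{a<N} ρ_a ≤ W`, `Wγ < b`), and a tail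
majorant `τ` of the memory profile (`Σ_{a∈[k,N)} ρ(a) ≤ τ(k)`, `τ ≥ 0` non-increasing) of POLYNOMIAL TYPE: (T1) `Σ_{a<N} ρ(a)min(a,K)² ≤
A₁K²τ(K)` (`K ≥ 1`), (T2) `Σ_{i<j₀} τ(i+1)τ(j₀−i)∕(j₀+1−i) ≤ A₂τ(j₀+1)`.  THEN for every infrared distance `m` with `A₂ ≤ b√b·√m` and every
cutoff `n ≥ m − 1`:  `astar g m − invSq g m n ≤ Λ·√m·τ(n+1)`, `Λ = 4∕√b + 8√2κA₁∕((1−Wγ∕b)√b)` — the lattice recursion variable `m` scales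
above the pin converges to the continuum one at the RATE OF THE PROFILE'S TAIL at the cutoff, times the root of the infrared distance
(generation 47's `continuum_monotone` gives the limit; `invSq_sub_le_rate` the bound at every larger cutoff).
[cite: Balaban1987RG1, (0.20) p.256, (0.31) and Thm 2 p.259] -/
theorem astar_sub_invSq_le_rate
    (hβ : ∀ (k : ℕ) (p : Fin (k + 1) → ℝ),
      β k p = b + ∑ i : Fin (k + 1), ρ (k - i) * min (p (Fin.last k)) (|p (Fin.last k) - p i|))
    (hb : 0 < b) (hγ : 0 < γ) (hρ0 : ∀ a, 0 ≤ ρ a) (hρW : ∀ n, ∑ a ∈ range n, ρ a ≤ W) (hsmall : W * γ < b)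
    (hτ0 : ∀ k, 0 ≤ τ k) (hτmono : ∀ k l, k ≤ l → τ l ≤ τ k)
    (hτ : ∀ k N, k ≤ N → ∑ a ∈ range N, ρ a - ∑ a ∈ range k, ρ a ≤ τ k) (hA₁ : 0 ≤ A₁)
    (hUV : ∀ K N : ℕ, 1 ≤ K → ∑ a ∈ range N, ρ a * (min (a : ℝ) K) ^ 2 ≤ A₁ * (K : ℝ) ^ 2 * τ K)
    (hT2 : ∀ j₀ : ℕ, ∑ i ∈ range j₀, τ (i + 1) * τ (j₀ - i) / ((j₀ + 1 - i : ℕ) : ℝ) ≤ A₂ * τ (j₀ + 1))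
    {g : ℕ → ℕ → ℝ} {gIR : ℝ} (hrun : ∀ K, RGEqH K β (g K)) (hbox : ∀ K i, i ≤ K → 0 < g K i ∧ g K i ≤ γ)
    (hpin : ∀ K, g K K = gIR) {m n : ℕ} (hm : A₂ ≤ b * Real.sqrt b * Real.sqrt (m : ℝ)) (hmn : m ≤ n + 1) :
    0 ≤ astar g m - invSq g m n ∧ astar g m - invSq g m n
      ≤ (4 / Real.sqrt b + 8 * Real.sqrt 2 * ((b + W * γ) / b) * A₁ / ((1 - W * γ / b) * Real.sqrt b))
        * Real.sqrt (m : ℝ) * τ (n + 1) := by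
  have ht : Tendsto (invSq g m) atTop (𝓝 (astar g m)) := (continuum_monotone hβ hb hγ hρ0 hρW hrun hbox hpin).1 m
  have hmono := invSq_mono hβ hb hρ0 hrun hbox hpin m
  have h1 : invSq g m n ≤ astar g m := hmono.ge_of_tendsto ht n
  set C : ℝ := (4 / Real.sqrt b + 8 * Real.sqrt 2 * ((b + W * γ) / b) * A₁ / ((1 - W * γ / b) * Real.sqrt b))
        * Real.sqrt (m : ℝ) * τ (n + 1) with hC
  have hev : ∀ᶠ k in atTop, invSq g m k ≤ invSq g m n + C := by
    refine Filter.eventually_atTop.mpr ⟨n, fun k hk => ?_⟩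
    obtain ⟨n', rfl⟩ := Nat.exists_eq_add_of_le hk
    have := invSq_sub_le_rate hβ hb hγ hρ0 hρW hsmall hτ0 hτmono hτ hA₁ hUV hT2 hrun hbox hpin hm hmn n'
    linarith
  have h2 : astar g m ≤ invSq g m n + C := le_of_tendsto ht hev
  constructor <;> linarith

end Summit.QuantumFields.BalabanUV.Beta.RemainderExplicitHistoryDiagonalRate

end
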